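import Summits.KontsevichZagierPeriods.KontsevichZagierPeriods.Theses.GenericPointClass

/-!
# `HyperbolaFormNotExact` (stmt-KontsevichZagierPeriods-4429, route GenericPointClass) — proof

Statement: there are no `A B D ∈ ℚ[X,Y]`, `D ≠ 0`, with
`D² = (1 - XY)·(∂₀A·D - A·∂₀D + ∂₁B·D - B·∂₁D)`, i.e. the 2-form `dx∧dy/(1-xy)` is not
`d(A/D dy - B/D dx)` — the algebraic heart of the "no descent for `ζ(2)`" card.

Proof (elementary, by reduction modulo a prime — a shadow of the Cartier operator; no residues).
1. Clear denominators (`exists_int_multiple`): the identity is homogeneous of degree two in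
   `(A, B, D)`, so it descends to `ℤ[X,Y]` (`MvPolynomial.map_injective`), with `D ≠ 0`.
2. Pick a prime `p` exceeding the absolute value of some non-zero coefficient of `D` and reduce
   modulo `p`; `pderiv` commutes with the reduction, and `D mod p ≠ 0`.
3. In `𝔽_p[X,Y]` (`charP_eq_zero`): with `π = 1 - XY`, `U = A·D^{p-1}`, `V = B·D^{p-1}` one has the
   polynomial identity `∂₀(π^p U) + ∂₁(π^p V) = π^{p-1}·D^p` (`frobenius_identity`: `∂(π^p) = 0`,
   `∂(D^{p-1}) = -D^{p-2}∂D`, and `D^{p-2}·D² = D^p`).  Compare coefficients at the monomial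
   `X^{pi+p-1} Y^{pj+p-1}`: on the left they vanish (`coeff_pderiv` produces the factor
   `pi + p = 0`); on the right `π^{p-1} = ∑_{k<p} (XY)^k` (geometric sum and `(1-XY)^p = 1-(XY)^p`)
   and `D^p = expand p D`, so the coefficient is `coeff (i,j) D`.  Hence `D = 0` — contradiction.
-/

namespace Summit.KontsevichZagierPeriods.GenericPointClass

open MvPolynomial

/-- The Frobenius-twisted divergence identity in characteristic `p = n + 2`: if
`D² = (1 - X₀X₁)·(∂₀A·D - A·∂₀D + ∂₁B·D - B·∂₁D)` then
`∂₀((1-X₀X₁)^p · A D^{p-1}) + ∂₁((1-X₀X₁)^p · B D^{p-1}) = (1-X₀X₁)^{p-1} D^p`. [folklore] -/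
theorem frobenius_identity (p n : ℕ) [Fact p.Prime] (hpn : p = n + 2)
    (A B D : MvPolynomial (Fin 2) (ZMod p))
    (h : D ^ 2 = (1 - X 0 * X 1) *
      (pderiv 0 A * D - A * pderiv 0 D + pderiv 1 B * D - B * pderiv 1 D)) :
    pderiv 0 ((1 - X 0 * X 1) ^ (n + 2) * (A * D ^ (n + 1)))
      + pderiv 1 ((1 - X 0 * X 1) ^ (n + 2) * (B * D ^ (n + 1)))
      = (1 - X 0 * X 1) ^ (n + 1) * D ^ (n + 2) := by
  have hc : ((n : MvPolynomial (Fin 2) (ZMod p)) + 2) = 0 := by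
    have : ((n + 2 : ℕ) : MvPolynomial (Fin 2) (ZMod p)) = 0 := by
      rw [← hpn]; exact CharP.cast_eq_zero _ p
    exact_mod_cast this
  simp only [pderiv_mul, pderiv_pow, map_sub, pderiv_one, pderiv_X_self,
    pderiv_X_of_ne (show (1 : Fin 2) ≠ 0 by decide),
    pderiv_X_of_ne (show (0 : Fin 2) ≠ 1 by decide), Nat.add_sub_cancel]
  push_cast
  linear_combination ((1 - X 0 * X 1) ^ (n + 1) * (-X 1) * (A * D ^ (n + 1))
    + (1 - X 0 * X 1) ^ (n + 1) * (-X 0) * (B * D ^ (n + 1))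
    + (1 - X 0 * X 1) ^ (n + 2) * A * D ^ n * pderiv 0 D
    + (1 - X 0 * X 1) ^ (n + 2) * B * D ^ n * pderiv 1 D) * hc
    - ((1 - X 0 * X 1) ^ (n + 1) * D ^ n) * h

/-- In characteristic `p` the identity `D² = (1 - X₀X₁)·(∂₀A·D - A·∂₀D + ∂₁B·D - B·∂₁D)` forces
`D = 0`: compare the coefficients of `X₀^{pi+p-1} X₁^{pj+p-1}` in `frobenius_identity` — zero on the
divergence side, `coeff (i,j) D` on the other (`(1-X₀X₁)^{p-1} = ∑_{k<p} (X₀X₁)^k`,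
`D^p = expand p D`). [folklore] -/
theorem charP_eq_zero (p : ℕ) [hp : Fact p.Prime] (A B D : MvPolynomial (Fin 2) (ZMod p))
    (h : D ^ 2 = (1 - X 0 * X 1) *
      (pderiv 0 A * D - A * pderiv 0 D + pderiv 1 B * D - B * pderiv 1 D)) :
    D = 0 := by
  obtain ⟨n, rfl⟩ : ∃ n, p = n + 2 := ⟨p - 2, (Nat.sub_add_cancel hp.out.two_le).symm⟩
  have key := frobenius_identity (n + 2) n rfl A B D h
  have hc : ((n : ZMod (n + 2)) + 2) = 0 := by exact_mod_cast ZMod.natCast_self (n + 2)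
  -- the geometric sum `(1 - X₀X₁)^(p-1) = ∑_{k<p} (X₀X₁)^k`
  have hgeom : (1 - X 0 * X 1 : MvPolynomial (Fin 2) (ZMod (n + 2))) ^ (n + 1)
      = ∑ k ∈ Finset.range (n + 2), (X 0 * X 1) ^ k := by
    have hne : (1 - X 0 * X 1 : MvPolynomial (Fin 2) (ZMod (n + 2))) ≠ 0 := by
      intro h0
      have := congrArg (coeff 0) h0
      simp [coeff_X_mul'] at this
    apply mul_left_cancel₀ hne
    rw [mul_neg_geom_sum, ← pow_succ', sub_pow_char, one_pow]
  have hXk : ∀ k : ℕ, ((X 0 * X 1) ^ k : MvPolynomial (Fin 2) (ZMod (n + 2)))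
      = monomial (k • (Finsupp.single 0 1 + Finsupp.single 1 1)) 1 := by
    intro k
    rw [mul_pow, X_pow_eq_monomial, X_pow_eq_monomial, monomial_mul, one_mul, smul_add,
      Finsupp.smul_single, Finsupp.smul_single, smul_eq_mul, mul_one]
  have hcoeff : ∀ i j : ℕ, coeff (Finsupp.single 0 i + Finsupp.single 1 j) D = 0 := by
    intro i j
    obtain ⟨e, he⟩ : ∃ e : Fin 2 →₀ ℕ, e = Finsupp.single 0 1 + Finsupp.single 1 1 := ⟨_, rfl⟩
    obtain ⟨m₀, hm₀⟩ : ∃ m₀ : Fin 2 →₀ ℕ, m₀ = Finsupp.single 0 i + Finsupp.single 1 j :=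
      ⟨_, rfl⟩
    obtain ⟨M, hM⟩ : ∃ M : Fin 2 →₀ ℕ, M = (n + 2) • m₀ + (n + 1) • e := ⟨_, rfl⟩
    have hMv0 : M 0 = (n + 2) * i + (n + 1) := by simp [hM, hm₀, he]
    have hMv1 : M 1 = (n + 2) * j + (n + 1) := by simp [hM, hm₀, he]
    have hL := congrArg (coeff M) key
    rw [coeff_add, coeff_pderiv, coeff_pderiv, hMv0, hMv1] at hL
    have hc0 : (((n + 2) * i + (n + 1) : ℕ) : ZMod (n + 2)) + 1 = 0 := by
      push_cast; linear_combination ((i : ZMod (n + 2)) + 1) * hc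
    have hc1 : (((n + 2) * j + (n + 1) : ℕ) : ZMod (n + 2)) + 1 = 0 := by
      push_cast; linear_combination ((j : ZMod (n + 2)) + 1) * hc
    rw [hc0, hc1, mul_zero, mul_zero, zero_add, hgeom, ← expand_zmod, Finset.sum_mul,
      coeff_sum] at hL
    rw [Finset.sum_eq_single (n + 1) ?_ (by simp)] at hL
    · rw [hXk, ← he, coeff_monomial_mul', if_pos ?_, one_mul, hM, add_tsub_cancel_right,
        coeff_expand_smul _ (by omega), hm₀] at hL
      · exact hL.symm
      · rw [hM]; exact le_add_self
    · intro k hk hkn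
      rw [hXk, ← he, coeff_monomial_mul']
      split_ifs with hle
      · rw [one_mul]
        refine coeff_expand_of_not_dvd _ (i := 0) ?_
        have hk' : k < n + 1 :=
          lt_of_le_of_ne (Nat.lt_succ_iff.mp (Finset.mem_range.mp hk)) hkn
        have hv : (M - k • e) 0 = (n + 2) * i + (n + 1 - k) := by
          simp [hM, hm₀, he]; omega
        rw [hv, Nat.dvd_add_right (dvd_mul_right _ _)]
        exact fun hd => absurd (Nat.le_of_dvd (by omega) hd) (by omega)
      · rfl
  ext m
  have hm : m = Finsupp.single 0 (m 0) + Finsupp.single 1 (m 1) := by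
    ext k; fin_cases k <;> simp
  rw [hm, coeff_zero]
  exact hcoeff _ _

/-- Clearing denominators: every `P ∈ ℚ[X,Y]` has a non-zero integer multiple coming from
`ℤ[X,Y]`. [folklore] -/
theorem exists_int_multiple (P : MvPolynomial (Fin 2) ℚ) :
    ∃ (N : ℤ) (P' : MvPolynomial (Fin 2) ℤ), N ≠ 0 ∧
      map (Int.castRingHom ℚ) P' = C (N : ℚ) * P := by
  induction P using MvPolynomial.monomial_add_induction_on with
  | C a =>
    refine ⟨a.den, C a.num, by exact_mod_cast a.den_nz, ?_⟩
    rw [map_C, ← C_mul, eq_intCast, Int.cast_natCast, mul_comm, Rat.mul_den_eq_num]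
  | monomial_add m b f _ _ ih =>
    obtain ⟨N, P', hN, hP⟩ := ih
    refine ⟨N * b.den, monomial m (N * b.num) + C (b.den : ℤ) * P', ?_, ?_⟩
    · exact mul_ne_zero hN (by exact_mod_cast b.den_nz)
    · have hb : (N : ℚ) * b.den * b = N * b.num := by
        rw [mul_assoc, mul_comm (b.den : ℚ) b, Rat.mul_den_eq_num]
      rw [map_add, map_mul (map (Int.castRingHom ℚ)), map_monomial, map_C, hP, eq_intCast,
        eq_intCast]
      push_cast
      rw [mul_add, C_mul_monomial, hb, C_mul]
      ring

/-- **`HyperbolaFormNotExact`** (route GenericPointClass, stmt-KontsevichZagierPeriods-4429): there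
are no `A B D : ℚ[X₀,X₁]` with `D ≠ 0` and `D² = (1 - X₀X₁)(∂₀A·D - A·∂₀D + ∂₁B·D - B·∂₁D)` — the
form `dx∧dy/(1-xy)` is not exact among rational forms.  Proof: clear denominators, reduce modulo a
prime `p` not dividing some coefficient of `D`, and apply the characteristic-`p` coefficient
obstruction `charP_eq_zero`. [folklore] -/
theorem hyperbolaFormNotExact_proof :
    Summit.KontsevichZagierPeriods.KontsevichZagierPeriods.Theses.GenericPointClass.HyperbolaFormNotExact := by
  rintro ⟨A, B, D, hD, h⟩
  obtain ⟨a, A', ha, hA⟩ := exists_int_multiple A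
  obtain ⟨b, B', hb, hB⟩ := exists_int_multiple B
  obtain ⟨d, D', hd, hD'⟩ := exists_int_multiple D
  -- a common multiplier `a * b * d`
  have hA2 : map (Int.castRingHom ℚ) (C (b * d) * A') = C ((a * b * d : ℤ) : ℚ) * A := by
    rw [map_mul, map_C, hA, ← mul_assoc, ← C_mul, eq_intCast]; push_cast; ring_nf
  have hB2 : map (Int.castRingHom ℚ) (C (a * d) * B') = C ((a * b * d : ℤ) : ℚ) * B := by
    rw [map_mul, map_C, hB, ← mul_assoc, ← C_mul, eq_intCast]; push_cast; ring_nf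
  have hD2 : map (Int.castRingHom ℚ) (C (a * b) * D') = C ((a * b * d : ℤ) : ℚ) * D := by
    rw [map_mul, map_C, hD', ← mul_assoc, ← C_mul, eq_intCast]; push_cast; ring_nf
  set A₂ := C (b * d) * A'
  set B₂ := C (a * d) * B'
  set D₂ := C (a * b) * D'
  -- the identity over `ℤ`
  have hZ : D₂ ^ 2 = (1 - X 0 * X 1) *
      (pderiv 0 A₂ * D₂ - A₂ * pderiv 0 D₂ + pderiv 1 B₂ * D₂ - B₂ * pderiv 1 D₂) := by
    apply map_injective (Int.castRingHom ℚ) Int.cast_injective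
    simp only [map_pow, map_mul, map_sub, map_add, map_one, map_X, ← pderiv_map, hA2, hB2, hD2,
      pderiv_C_mul]
    linear_combination (C ((a * b * d : ℤ) : ℚ)) ^ 2 * h
  have hD₂0 : D₂ ≠ 0 := by
    intro h0
    have : map (Int.castRingHom ℚ) D₂ = 0 := by rw [h0, map_zero]
    rw [hD2] at this
    refine mul_ne_zero ?_ hD this
    exact C_ne_zero.mpr (by exact_mod_cast mul_ne_zero (mul_ne_zero ha hb) hd)
  -- reduce modulo a prime exceeding a non-zero coefficient of `D₂`
  obtain ⟨m₀, hm₀⟩ := MvPolynomial.ne_zero_iff.mp hD₂0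
  obtain ⟨p, hple, hpp⟩ := Nat.exists_infinite_primes ((coeff m₀ D₂).natAbs + 1)
  haveI := Fact.mk hpp
  have hmod := congrArg (map (Int.castRingHom (ZMod p))) hZ
  simp only [map_pow, map_mul, map_sub, map_add, map_one, map_X, ← pderiv_map] at hmod
  have hzero := charP_eq_zero p _ _ _ hmod
  have hc : ((coeff m₀ D₂ : ℤ) : ZMod p) = 0 := by
    have := congrArg (coeff m₀) hzero
    simpa [coeff_map] using this
  rw [ZMod.intCast_zmod_eq_zero_iff_dvd] at hc
  refine hm₀ (Int.eq_zero_of_abs_lt_dvd hc ?_)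
  rw [Int.abs_eq_natAbs]
  exact_mod_cast Nat.lt_of_succ_le hple

end Summit.KontsevichZagierPeriods.GenericPointClass
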